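import Literature.NumberTheory.LFunctions.WeilBlockRows
import HarnessLib

/-!
# Row-wise block checks from a MATERIALIZED rounded moment matrix

Topic: `Literature/NumberTheory/LFunctions`. The row check `WeilCert.checkDomRow ν κ p i` of
`WeilBlockRows.lean` recomputes, for every row `i`, the `nb × nb` entries `P_r(2k+p, 2l+p)` of the rounded
moment matrix (`WeilCert.prQ`: factorials, a table look-up and a dyadic rounding each) — `nb³` such
evaluations for a whole block, which for `nb ≈ 75` no longer fits the kernel budget of one declaration per
row. Here the parity block of `P_r` is supplied as DATA `Pm` (`getM Pm k l` claimed `= P_r(2k+p, 2l+p)`):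

* `WeilCert.checkPmRow ν Pm p k` — row `k` of the claim, checked once (`nb` evaluations of `prQ`);
* `WeilCert.rRowP Pm κ p i`, `WeilCert.checkDomRowP Pm κ p i` — the row of `R = S' − UᵀU` and its one-sided
  dominance computed from `Pm` (about `2 nb²` products, no `prQ`);
* **`WeilCert.checkDomRow_of_P`**: the claim rows and `checkDomRowP` give `checkDomRow`, so
  `WeilCert.checkBlockK_of_rows` applies unchanged.

Pure bookkeeping; everything here is proved.
-/

noncomputable section

open Finset
open scoped BigOperators

namespace Literature.NumberTheory.LFunctions

namespace WeilCert

variable (c : WeilCert)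

/-- Row `k` of the claim "`Pm` is the parity block `p` of `P_r(ν)`": `Pm_{kl} = P_r(2k+p, 2l+p)` for all
`l < nb`. [folklore] -/
def checkPmRow (nu : List ℚ) (Pm : List (List ℚ)) (p k : ℕ) : Bool :=
  allBelow c.nb fun l ↦ decide (getM Pm k l = c.prQ nu (2 * k + p) (2 * l + p))

/-- Row `i` of `Dᵀ P_r` from the materialized block: `w_l = Σ_k D_{ki} Pm_{kl}`. [folklore] -/
def dtpRowP (Pm : List (List ℚ)) (p i : ℕ) : List ℚ :=
  tabV c.nb fun l ↦ sumR c.nb fun k ↦ getM (c.Db p) k i * getM Pm k l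

/-- Row `i` of `R = S' − UᵀU` from the materialized block. [folklore] -/
def rRowP (Pm : List (List ℚ)) (κ : ℚ) (p i : ℕ) : List ℚ :=
  let w := c.dtpRowP Pm p i
  let ch := c.chRow p i
  tabV c.nb fun j ↦
    ((sumR c.nb fun l ↦ getV w l * getM (c.Db p) l j) +
        κ * ((if i = j then 2 * c.bQ p i else 0) -
          c.bQ p i * c.bQ p j * (sumR c.nb fun l ↦ getV ch l * getM (c.Cb p) j l))) -
      sumR c.nb fun k ↦ getM (c.Ub p) k i * getM (c.Ub p) k j

/-- One-sided dominance of row `i` of `R`, from the materialized block. [folklore] -/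
def checkDomRowP (Pm : List (List ℚ)) (κ : ℚ) (p i : ℕ) : Bool :=
  let r := c.rRowP Pm κ p i
  decide ((sumR c.nb fun j ↦ if j = i then 0 else |getV r j|) ≤ getV r i)

variable {c}

/-- A checked claim row gives the entries of `P_r`. [folklore] -/
theorem getM_of_checkPmRow {nu : List ℚ} {Pm : List (List ℚ)} {p k : ℕ}
    (h : c.checkPmRow nu Pm p k = true) {l : ℕ} (hl : l < c.nb) :
    getM Pm k l = c.prQ nu (2 * k + p) (2 * l + p) := by
  unfold checkPmRow at h
  have := of_allBelow h hl
  rwa [decide_eq_true_eq] at this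

/-- With all claim rows checked, the materialized `Dᵀ P_r` row is the genuine one. [folklore] -/
theorem dtpRowP_eq {nu : List ℚ} {Pm : List (List ℚ)} {p : ℕ}
    (hPm : ∀ k < c.nb, c.checkPmRow nu Pm p k = true) (i : ℕ) :
    c.dtpRowP Pm p i = c.dtpRow nu p i := by
  unfold dtpRowP dtpRow tabV
  refine List.map_congr_left fun l hl ↦ ?_
  rw [List.mem_range] at hl
  rw [sumR_eq_sum, sumR_eq_sum]
  refine Finset.sum_congr rfl fun k hk ↦ ?_
  rw [getM_of_checkPmRow (hPm k (Finset.mem_range.1 hk)) hl]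

/-- With all claim rows checked, the materialized row of `R` is the genuine one. [folklore] -/
theorem rRowP_eq {nu : List ℚ} {Pm : List (List ℚ)} {p : ℕ}
    (hPm : ∀ k < c.nb, c.checkPmRow nu Pm p k = true) (κ : ℚ) (i : ℕ) :
    c.rRowP Pm κ p i = c.rRow nu κ p i := by
  unfold rRowP rRow
  dsimp only
  rw [dtpRowP_eq hPm i]

/-- **`checkDomRow` from the materialized block.** [folklore] -/
theorem checkDomRow_of_P {nu : List ℚ} {Pm : List (List ℚ)} {κ : ℚ} {p i : ℕ}
    (hPm : ∀ k < c.nb, c.checkPmRow nu Pm p k = true) (h : c.checkDomRowP Pm κ p i = true) :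
    c.checkDomRow nu κ p i = true := by
  unfold checkDomRowP at h
  unfold checkDomRow
  dsimp only at h ⊢
  rwa [rRowP_eq hPm κ i] at h

end WeilCert

end Literature.NumberTheory.LFunctions
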